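import Summits.QuantumFields.BalabanUV.T4Continuum.Support.NE7LawLevelStabilityDefect

/-!
# NE7, ROAD P4 (law-level): NODE Q TYPED TO THE BOTTOM — mean factors, the ONE-RUN pure-average L¹ rate (Q.old as a
# shape), and the window-sandwich route to `RecentResamplingRate` (Q.rec) through the defect stability lemma

(Cell `pub-balaban`, sub-cell `t4`, binder row NE7 = node U5, co-owner #4 `b2b-balaban-t4-ne7-p4`; skeleton
`HOME/t4/skeletons/NE7-t4-ne7-p4.md` §2 NODE Q.  Imports `NE7LawLevelStabilityDefect` (p208207) and through it the road's
files `NE7LawLevelStability` p207751, `NE7LawLevelAssembly` p207170, `NE7LawLevelSocket` p206810.)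

HONEST FRAMING (T4-DAG PAGE 1).  Rung (B)+1 on ONE FIXED finite four-torus, CONDITIONAL on `BetaPertH` and the nine
spine estimates (0/9 proved); NOT infinite volume, NOT a mass gap, NOT the Clay problem.  NE7 is NOT PRINTED and NOT
proved here; every `def … : Prop` below is a HYPOTHESIS SHAPE, every theorem [folklore] measure theory ∕ bookkeeping,
sorry-free; no statement of the audited series is asserted; NOT summit progress.

WHAT THIS FILE DOES.  NODE Q of the road asks for a rate `q_K` of the conditional dressing means; `NE7LawLevelAssembly`
§5b cut it as `m = w + dold + drec` with the shapes `OldResamplingSmall` (old resampling TIMES, single-run) and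
`RecentResamplingRate` (recent times).  Here both shapes are PRODUCED from typed inputs one level down:
* §1 `IsMeanFactor P Y F m` (a set-integral factor of `F` through `Y`) and its L¹-CONTRACTION
  `integral_abs_le_of_isMeanFactor` (`∫|m| d(Y_*P) ≤ ∫|F| dP`);
* §2 Q.old TYPED: the ONE-RUN shape `PureAverageL1Rate` — per `K`, on run `K`'s chain, the true dressing `F_K` and the
  PURE-AVERAGE dressing `Φ̃_K` of the time-`(K − n₀)` state differ in `L¹(P_K)` by `≤ C·s_K` — and
  `oldResamplingSmall_of_pureAverageL1Rate` (the skeleton's Q.old-geom ∕ Q.old-count ∕ Q.old-c ∕ Q.old-fluct are what a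
  producer of `PureAverageL1Rate` for Bałaban's chain consists of; Q.old-c is its one open piece);
* §3 Q.rec TYPED: the shape `WindowSandwich` — per `K`, run `K+1`'s window law is the tilt of run `K`'s by a path
  functional sandwiched with radius `R_K` off a bad set of defects `w_K, w′_K`, and the two runs' recent dressing
  corrections are mean factors of ONE window functional under the two laws — and
  `recentResamplingRate_of_windowSandwich` (by `integral_abs_dressing_sub_le_of_sandwich_off`).  The window sandwich is
  the window-level instance of the road's leaves S ∕ W ∕ D (shared with road P1 at source zero); the factor
  identifications are [dict] over the chain (NODE O).
So after this file NODE Q's binders are: a chain∕window REALISATION ([dict]), the window-level sandwich (SHARED), the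
pure-average L¹ rate (ONE-RUN, open: Q.old-c inside), and kernel lemmas.
-/

noncomputable section

open MeasureTheory

namespace Summit.QuantumFields.BalabanUV.T4Continuum.NE7LawLevel

open Literature.MathematicalPhysics.QuantumFieldTheory.Balaban1983to89
open T4VarianceMatching

/-! ## §1 Mean factors and their L¹ contraction -/

section Factor

variable {Ω X : Type*} [MeasurableSpace Ω] [MeasurableSpace X]

/-- `m` is a MEAN FACTOR of `F` through `Y` under `P`: measurable, and `∫_{Y⁻¹A} F dP = ∫_A m d(P.map Y)` for every
measurable `A` (a version of `E_P[F ∣ Y]` as a function on the target; `NE7LawLevelDressing.exists_condMean_factor`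
produces one for bounded `F`). [folklore] -/
def IsMeanFactor (P : Measure Ω) (Y : Ω → X) (F : Ω → ℝ) (m : X → ℝ) : Prop :=
  Measurable m ∧ ∀ A : Set X, MeasurableSet A → ∫ ω in Y ⁻¹' A, F ω ∂P = ∫ x in A, m x ∂(P.map Y)

/-- Mean factors are linear: a factor of `F` minus a factor of `G` is a factor of `F − G` (integrable `F, G`, bounded
factors). [folklore] -/
theorem IsMeanFactor.sub {P : Measure Ω} [IsFiniteMeasure P] {Y : Ω → X} {F G : Ω → ℝ}
    {m n : X → ℝ} (hm : IsMeanFactor P Y F m) (hn : IsMeanFactor P Y G n) (hFi : Integrable F P)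
    (hGi : Integrable G P) (hmi : Integrable m (P.map Y)) (hni : Integrable n (P.map Y)) :
    IsMeanFactor P Y (fun ω => F ω - G ω) (fun x => m x - n x) := by
  refine ⟨hm.1.sub hn.1, fun A hA => ?_⟩
  rw [integral_sub hFi.integrableOn hGi.integrableOn, integral_sub hmi.integrableOn hni.integrableOn, hm.2 A hA,
    hn.2 A hA]

/-- A function of `Y` is its own mean factor: `w ∘ Y` has factor `w`. [folklore] -/
theorem isMeanFactor_comp {P : Measure Ω} {Y : Ω → X} (hY : Measurable Y) {w : X → ℝ} (hw : Measurable w) :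
    IsMeanFactor P Y (fun ω => w (Y ω)) w :=
  ⟨hw, fun _ hA => (setIntegral_map hA hw.aestronglyMeasurable hY.aemeasurable).symm⟩

/-- **L¹ CONTRACTION of mean factors**: `∫ |m| d(P.map Y) ≤ ∫ |F| dP` (bounded measurable `m`, integrable `F`).
[folklore] -/
theorem integral_abs_le_of_isMeanFactor {P : Measure Ω} [IsFiniteMeasure P] {Y : Ω → X} (hY : Measurable Y)
    {F : Ω → ℝ} (hFi : Integrable F P) {m : X → ℝ} (hm : IsMeanFactor P Y F m) {b : ℝ} (hb : ∀ x, |m x| ≤ b) :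
    ∫ x, |m x| ∂(P.map Y) ≤ ∫ ω, |F ω| ∂P := by
  haveI : IsFiniteMeasure (P.map Y) := Measure.isFiniteMeasure_map P Y
  set ν := P.map Y with hν
  have hmi : Integrable m ν := integrable_of_abs_le ν hm.1 (B := b) hb
  have hAp : MeasurableSet {x | 0 ≤ m x} := measurableSet_le measurable_const hm.1
  -- split ∫|m| over {m ≥ 0} and its complement
  rw [← integral_add_compl hAp hmi.abs]
  have e1 : ∫ x in {x | 0 ≤ m x}, |m x| ∂ν = ∫ x in {x | 0 ≤ m x}, m x ∂ν :=
    setIntegral_congr_fun hAp fun x hx => abs_of_nonneg hx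
  have e2 : ∫ x in {x | 0 ≤ m x}ᶜ, |m x| ∂ν = -∫ x in {x | 0 ≤ m x}ᶜ, m x ∂ν := by
    rw [← integral_neg]
    refine setIntegral_congr_fun hAp.compl fun x hx => ?_
    simp only [Set.mem_compl_iff, Set.mem_setOf_eq, not_le] at hx
    exact abs_of_neg hx
  rw [e1, e2, ← hm.2 _ hAp, ← hm.2 _ hAp.compl]
  -- each piece ≤ the integral of |F| over the same preimage; the preimages partition Ω
  have h1 : ∫ ω in Y ⁻¹' {x | 0 ≤ m x}, F ω ∂P ≤ ∫ ω in Y ⁻¹' {x | 0 ≤ m x}, |F ω| ∂P :=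
    setIntegral_mono hFi.integrableOn hFi.abs.integrableOn fun ω => le_abs_self _
  have h2 : -∫ ω in Y ⁻¹' {x | 0 ≤ m x}ᶜ, F ω ∂P ≤ ∫ ω in Y ⁻¹' {x | 0 ≤ m x}ᶜ, |F ω| ∂P := by
    rw [← integral_neg]
    exact setIntegral_mono hFi.neg.integrableOn hFi.abs.integrableOn fun ω => neg_le_abs _
  have hsplit : ∫ ω in Y ⁻¹' {x | 0 ≤ m x}, |F ω| ∂P + ∫ ω in Y ⁻¹' {x | 0 ≤ m x}ᶜ, |F ω| ∂P = ∫ ω, |F ω| ∂P :=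
    integral_add_compl (hY hAp) hFi.abs
  linarith

end Factor

/-! ## §2 Q.old TYPED: the one-run pure-average L¹ rate ⇒ `OldResamplingSmall` -/

section Old

variable {O : Type*}
variable {X : Type*} [MeasurableSpace X]

/-- **Q.old TYPED (ONE-RUN hypothesis shape, NOT PRINTED): the PURE-AVERAGE L¹ RATE.**  For every `K` run `K`'s chain
is realised on a probability space `(Ω K, P K)` with endpoint `Y K` of law `ν K`; for every string `os` it carries the
TRUE dressing `F K os` (`= ∏_{o} W_o ∘ avg^K ∘ U₀`) and the PURE-AVERAGE dressing `Φp K os` (`= ∏_{o} W_o ∘ avg^{n₀(K)}`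
of the chain's state at time `K − n₀(K)`: the old resamplings kept, the recent ones undone), both measurable and bounded
by `1`, with `∫ |F K os − Φp K os| d(P K) ≤ C_os · s_K`.  For Bałaban's chain this is the statement «the resamplings
OLDER than the window move a unit-scale class function by a summable amount in L¹, in ONE run» — what its producer
consists of is the skeleton's Q.old-geom (dilution) ∕ Q.old-count ((0.1) creation probabilities) ∕ Q.old-fluct (ℓ²) and
the OPEN one-run piece Q.old-c (first-order centering of the inhomogeneous mean kick field). [folklore] -/
def PureAverageL1Rate (Ω : ℕ → Type*) [∀ K, MeasurableSpace (Ω K)] (P : ∀ K, Measure (Ω K))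
    (F Φp : ∀ K, List O → Ω K → ℝ) (s : ℕ → ℝ) : Prop :=
  ∀ os, ∃ C : ℝ, 0 ≤ C ∧ ∀ K, Measurable (F K os) ∧ Measurable (Φp K os) ∧ (∀ ω, |F K os ω| ≤ 1) ∧
    (∀ ω, |Φp K os ω| ≤ 1) ∧ 0 ≤ s K ∧ ∫ ω, |F K os ω - Φp K os ω| ∂(P K) ≤ C * s K

/-- **Q.old from the pure-average L¹ rate.**  If `dold K os` is a mean factor of `F K os − Φp K os` through `Y K`
(bounded by `2`) and `ν K = (P K).map (Y K)`, the pure-average L¹ rate gives `OldResamplingSmall ν dold s` — by the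
L¹ contraction of mean factors. [folklore] -/
theorem oldResamplingSmall_of_pureAverageL1Rate {Ω : ℕ → Type*} [∀ K, MeasurableSpace (Ω K)] (P : ∀ K, Measure (Ω K))
    [∀ K, IsProbabilityMeasure (P K)] {Y : ∀ K, Ω K → X} (hY : ∀ K, Measurable (Y K)) {F Φp : ∀ K, List O → Ω K → ℝ}
    {s : ℕ → ℝ} (h : PureAverageL1Rate Ω P F Φp s) {ν : ℕ → Measure X} (hν : ∀ K, (P K).map (Y K) = ν K)
    {dold : ℕ → List O → X → ℝ}
    (hfac : ∀ K os, IsMeanFactor (P K) (Y K) (fun ω => F K os ω - Φp K os ω) (dold K os))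
    (hb : ∀ K os x, |dold K os x| ≤ 2) : OldResamplingSmall ν dold s := by
  intro os
  obtain ⟨C, hC0, hC⟩ := h os
  refine ⟨C, hC0, fun K => ?_⟩
  obtain ⟨hFm, hΦm, hFb, hΦb, hs0, hL1⟩ := hC K
  refine ⟨(hfac K os).1, hb K os, hs0, ?_⟩
  have hFi : Integrable (fun ω => F K os ω - Φp K os ω) (P K) :=
    integrable_of_abs_le (P K) (hFm.sub hΦm) (B := 2) fun ω =>
      (abs_sub _ _).trans (by linarith [hFb ω, hΦb ω])
  rw [← hν K]
  exact (integral_abs_le_of_isMeanFactor (hY K) hFi (hfac K os) (hb K os)).trans hL1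

end Old

/-! ## §3 Q.rec TYPED: the window sandwich ⇒ `RecentResamplingRate` through the defect stability lemma -/

section Recent

variable {O : Type*} {X : Type*} [MeasurableSpace X]

/-- The rate produced by the defect stability lemma from a window radius `R` and defects `w, w′`. [folklore] -/
def windowRate (R w w' : ℝ) : ℝ :=
  2 * (Real.exp (2 * R) / (1 - w) - Real.exp (-(2 * R)) * (1 - w')) * (1 / (Real.exp (-(2 * R)) * (1 - w')) + 2 * w) +
    4 * (w + w')

/-- The window rate is nonnegative for `0 ≤ R`, `0 ≤ w < 1`, `0 ≤ w′ < 1`. [folklore] -/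
theorem windowRate_nonneg {R w w' : ℝ} (hR : 0 ≤ R) (hw0 : 0 ≤ w) (hw1 : w < 1) (hw'0 : 0 ≤ w') (hw'1 : w' < 1) :
    0 ≤ windowRate R w w' := by
  unfold windowRate
  have h1w : 0 < 1 - w := by linarith
  have h1w' : 0 < 1 - w' := by linarith
  have hl0 : 0 < Real.exp (-(2 * R)) * (1 - w') := mul_pos (Real.exp_pos _) h1w'
  have hexp1 : Real.exp (-(2 * R)) ≤ 1 := by rw [← Real.exp_zero]; exact Real.exp_le_exp.mpr (by linarith)
  have hl1 : Real.exp (-(2 * R)) * (1 - w') ≤ 1 := by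
    calc Real.exp (-(2 * R)) * (1 - w') ≤ 1 * (1 - w') := mul_le_mul_of_nonneg_right hexp1 h1w'.le
      _ ≤ 1 := by linarith
  have hu1 : 1 ≤ Real.exp (2 * R) / (1 - w) := by
    rw [le_div_iff₀ h1w]
    calc 1 * (1 - w) ≤ 1 := by linarith
      _ ≤ Real.exp (2 * R) := Real.one_le_exp (by linarith)
  have hρ : 0 ≤ Real.exp (2 * R) / (1 - w) - Real.exp (-(2 * R)) * (1 - w') := by linarith
  positivity

/-- **Q.rec TYPED (hypothesis shape over a WINDOW REALISATION; its analytic content is the window-level instance of the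
road's leaves S ∕ W ∕ D).**  For every `K`: a probability space `(Ω K, P K)` (run `K`'s law of the recent window of the
chain) with endpoint `Y K` of law `ν K`; a bounded measurable path tilt `f K` such that `(P K).tilted (f K)` is run
`K+1`'s window law, with endpoint law `ν (K+1)`; a bad set `B K` off which `|f K − c K| ≤ R K`, of masses `≤ w K < 1`
under `P K` and `≤ w′ K < 1` under the tilt; and, for every string, the window functional `Φ K os` (`|Φ| ≤ 1`; for
Bałaban: half the difference of the pure-average dressing and the endpoint observable) whose mean factors through `Y K`
under the two laws are `drec K os ∕ 2` and `drec (K+1) os ∕ 2`.  NOT PRINTED; the factor identifications are [dict]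
over the chain. [folklore] -/
def WindowSandwich (Ω : ℕ → Type*) [∀ K, MeasurableSpace (Ω K)] (P : ∀ K, Measure (Ω K)) (Y : ∀ K, Ω K → X)
    (ν : ℕ → Measure X) (f : ∀ K, Ω K → ℝ) (B : ∀ K, Set (Ω K)) (c R w w' : ℕ → ℝ) (Φ : ∀ K, List O → Ω K → ℝ)
    (drec : ℕ → List O → X → ℝ) : Prop :=
  ∀ K, Measurable (Y K) ∧ Measurable (f K) ∧ (∃ Bf : ℝ, ∀ ω, |f K ω| ≤ Bf) ∧ MeasurableSet (B K) ∧
    (∀ ω, ω ∉ B K → |f K ω - c K| ≤ R K) ∧ 0 ≤ R K ∧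
    (P K).real (B K) ≤ w K ∧ w K < 1 ∧ ((P K).tilted (f K)).real (B K) ≤ w' K ∧ w' K < 1 ∧
    (P K).map (Y K) = ν K ∧ ((P K).tilted (f K)).map (Y K) = ν (K + 1) ∧
    ∀ os, Measurable (Φ K os) ∧ (∀ ω, |Φ K os ω| ≤ 1) ∧
      Measurable (drec K os) ∧ Measurable (drec (K + 1) os) ∧
      (∀ x, |drec K os x| ≤ 2) ∧ (∀ x, |drec (K + 1) os x| ≤ 2) ∧
      (∀ A : Set X, MeasurableSet A →
        ∫ ω in Y K ⁻¹' A, Φ K os ω ∂(P K) = ∫ x in A, drec K os x / 2 ∂((P K).map (Y K))) ∧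
      (∀ A : Set X, MeasurableSet A →
        ∫ ω in Y K ⁻¹' A, Φ K os ω ∂((P K).tilted (f K)) =
          ∫ x in A, drec (K + 1) os x / 2 ∂(((P K).tilted (f K)).map (Y K)))

/-- **Q.rec from the window sandwich** (defect stability lemma, `NE7LawLevelStabilityDefect`):
`RecentResamplingRate ν drec (fun K => 2 · windowRate (R K) (w K) (w′ K))`. [folklore] -/
theorem recentResamplingRate_of_windowSandwich {Ω : ℕ → Type*} [∀ K, MeasurableSpace (Ω K)]
    {P : ∀ K, Measure (Ω K)} [∀ K, IsProbabilityMeasure (P K)] {Y : ∀ K, Ω K → X} {ν : ℕ → Measure X}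
    {f : ∀ K, Ω K → ℝ} {B : ∀ K, Set (Ω K)} {c R w w' : ℕ → ℝ} {Φ : ∀ K, List O → Ω K → ℝ}
    {drec : ℕ → List O → X → ℝ} (h : WindowSandwich Ω P Y ν f B c R w w' Φ drec) :
    RecentResamplingRate ν drec fun K => 2 * windowRate (R K) (w K) (w' K) := by
  intro os
  refine ⟨1, zero_le_one, fun K => ?_⟩
  obtain ⟨hY, hf, ⟨Bf, hfB⟩, hB, hR, hR0, hw, hw1, hw', hw'1, hνK, hνK1, hos⟩ := h K
  obtain ⟨hΦm, hΦb, hm0, hm1, hb0, hb1, hfac0, hfac1⟩ := hos os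
  have hw0 : 0 ≤ w K := le_trans measureReal_nonneg hw
  have hw'0 : 0 ≤ w' K := le_trans measureReal_nonneg hw'
  refine ⟨hm0, hm1, fun u => (abs_sub _ _).trans (by linarith [hb0 u, hb1 u]),
    mul_nonneg zero_le_two (windowRate_nonneg hR0 hw0 hw1 hw'0 hw'1), ?_⟩
  -- apply the defect stability lemma to the half-factors
  have key := integral_abs_dressing_sub_le_of_sandwich_off (P K) hf hfB hB hR hR0 hw hw1 hw' hw'1 hY hΦm hΦb
    (mP := fun x => drec K os x / 2) (mQ := fun x => drec (K + 1) os x / 2) (hm0.div_const 2) (hm1.div_const 2)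
    (fun x => by rw [abs_div, abs_two]; linarith [hb0 x]) (fun x => by rw [abs_div, abs_two]; linarith [hb1 x])
    hfac0 hfac1
  rw [hνK1] at key
  have e : ∀ x, |drec (K + 1) os x - drec K os x| = 2 * |drec (K + 1) os x / 2 - drec K os x / 2| := fun x => by
    rw [← sub_div, abs_div, abs_two]; ring
  simp_rw [e]
  rw [integral_const_mul, one_mul]
  unfold windowRate
  linarith

end Recent

end Summit.QuantumFields.BalabanUV.T4Continuum.NE7LawLevel

end
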